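import Summits.Langlands.Langlands.Theses.IrreducibilityBySelfDuality
import Literature.NumberTheory.Automorphic.UnitaryCoherentGaloisRep
import Literature.NumberTheory.Automorphic.HarrisLanTaylorThorneCor627
import Literature.NumberTheory.GaloisRepresentations.GaloisRepOfAlgebraValuedLimit

/-!
# Sketch — crux stmt-Langlands-16722 `GaloisRepGL2CMae`, idea `u22-twisted-pair-limit`
(crux-ideate round 1, ideator 1).  Statements only; everything elaborates, nothing is proved here
except definitional bookkeeping.

* `twistedPairPoly`      — HLTT's prescription `P_v^{(N)} = arithFrobPolyOfSatake ι q_v 2 α_v · ∏_{b∈B_v}(X − b q_v^{−2N})`.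
* `IsGoodPlace`          — the places where Cor 6.27 (unramified alternative) is consumed.
* `TwistedPairLimitU22`  — the stub (α)₂: an AUTOMORPHIC congruence statement on `U_{K/K⁺}(4)`, no Galois group in it,
                            in the `happrox` shape of the PROVED `exists_semisimple_galoisRep_of_algebraValuedLimit`.
* `Cor627UnramTwo`       — Cor 6.27 at `n = 2`, unramified alternative only (what `theorem713_of_goodPlaces` consumes).
* `FirstLemma`           — (α)₂ → (β) [= the in-tree named fact `HarrisLanTaylorThorne2016_galoisRep_unitary_discreteSeries`]
                            → `Cor627UnramTwo`.
-/

namespace Summit.Langlands.Langlands.Cruxes.GaloisRepGL2CMae.Sketch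

open Polynomial IsDedekindDomain NumberField
open Literature.NumberTheory.Automorphic Literature.NumberTheory.GaloisRepresentations

noncomputable section

/-- HLTT Cor 6.27's prescribed Frobenius polynomial at a good place, rank `n = 2`:
the Satake factor of `σ_v` times the factor of the conjugate-dual summand shifted by `ε_p^{-2N}`. -/
def twistedPairPoly {p : ℕ} [Fact p.Prime] (ι : PadicAlgCl p ≃+* ℂ) (q : ℕ) (N : ℕ)
    (α : Multiset ℂ) (B : Multiset (PadicAlgCl p)) : (PadicAlgCl p)[X] :=
  arithFrobPolyOfSatake ι q 2 α *
    (B.map fun b ↦ X - C (b * ((q : PadicAlgCl p)⁻¹) ^ (2 * N))).prod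

/-- `v` is a good place for `(π, E₀, p)`: `v ∣ q` with `q ≠ p` a rational prime unramified in `K`
above which `π` is unramified (the alternative of Cor 6.27 the landed §7 glue consumes, `Or.inr`). -/
def IsGoodPlace {K : Type} [Field K] [NumberField K] {hcpt : isCompact_glFiniteIntegralLevel 2 K}
    (π : CuspidalAutomorphicRepData 2 K hcpt) (p : ℕ) (v : HeightOneSpectrum (𝓞 K)) : Prop :=
  ∃ q : ℕ, q.Prime ∧ q ≠ p ∧ ((q : ℕ) : 𝓞 K) ∈ v.asIdeal ∧
    Algebra.IsUnramifiedIn (𝓞 K) (Ideal.span {(q : ℤ)}) ∧ π.1.IsUnramifiedAbove q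

/-- **(α)₂ `TwistedPairLimitU22`** — the unique stub of the line.  For `K` CM presented as a
quadratic extension of the totally real `Fp = K⁺` with involution `cK`, an imaginary quadratic
`E₀ ⊆ K` in which `p` splits (HLTT's standing notation), `π` regular algebraic cuspidal on
`GL₂(𝔸_K)` and `ι : ℚ̄_p ≃ ℂ`: for all `N ≥ N₀` the twisted-pair prescription `P^{(N)}` (defined off
a finite exceptional set `S`, coefficients in a finite `E/ℚ_p`, pinned at good places by the Satake
parameters of `π`) is, for every `m`, an algebra-valued `p^{-m}`-limit of the base-change Satake
polynomials of finitely many CUSPIDAL automorphic representations of Mok's quasi-split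
`U_{K/K⁺}(4)` whose archimedean components are (regular) discrete series and which are unramified
above `p` and at the relevant places.  Printed source: HLTT 2016 Lemma 6.2–Cor 6.26 (with Katz's
lemma and the vanishing `H^j(X^{ord,†}, E^sub) = 0`, j > 0) at `n = 2`, `G₂ = GU(2,2)`. -/
def TwistedPairLimitU22 : Prop :=
  ∀ (Fp K : Type) [Field Fp] [NumberField Fp] [Field K] [NumberField K] [Algebra Fp K]
    (cK : K ≃ₐ[Fp] K), IsTotallyReal Fp → Module.finrank Fp K = 2 → ∀ (hc : cK ≠ 1),
    IsTotallyComplex K →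
    ∀ (hcpt : isCompact_glFiniteIntegralLevel 2 K) (p : ℕ) [Fact p.Prime]
      (E₀ : IntermediateField ℚ K), Module.finrank ℚ E₀ = 2 ∧ IsTotallyComplex E₀ →
      HasTwoPrimesOver E₀ p →
    ∀ (π : CuspidalAutomorphicRepData 2 K hcpt), π.1.IsRegularAlgebraic →
    ∀ (ι : PadicAlgCl p ≃+* ℂ),
    ∃ (N₀ : ℕ) (B : HeightOneSpectrum (𝓞 K) → Multiset (PadicAlgCl p))
      (E : IntermediateField ℚ_[p] (PadicAlgCl p)) (S : Set (HeightOneSpectrum (𝓞 K))),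
      FiniteDimensional ℚ_[p] E ∧ S.Finite ∧
      (∀ v, Multiset.card (B v) = 2 ∧ (0 : PadicAlgCl p) ∉ B v) ∧
      (∀ v, IsGoodPlace π p v → v ∉ S) ∧
      (∀ v ∈ S, ((p : ℕ) : 𝓞 K) ∉ v.asIdeal →
        ∀ v' : HeightOneSpectrum (𝓞 K), v'.asIdeal.under ℤ = v.asIdeal.under ℤ → v' ∈ S) ∧
      ∀ N, N₀ ≤ N →
        ∃ P : HeightOneSpectrum (𝓞 K) → (PadicAlgCl p)[X],
          (∀ v, IsGoodPlace π p v → ∀ α : Multiset ℂ, π.1.HasSatakeParamAt v α →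
              P v = twistedPairPoly ι v.residueCard N α (B v)) ∧
          (∀ v ∉ S, ∀ k : ℕ, (P v).coeff k ∈ E) ∧
          ∀ m : ℕ, ∃ (r : ℕ) (hcpt4 : isCompact_glFiniteIntegralLevel 4 K)
              (σ' : Fin r → UnitaryGroup.CuspidalAutomorphicRepData Fp K cK 4 hcpt4)
              (Q : Fin r → HeightOneSpectrum (𝓞 K) → (PadicAlgCl p)[X]) (δ : ℝ), 0 < δ ∧
            (∀ i (w : {w : InfinitePlace K // w.IsComplex}) (hw : cK • w.1 = w.1),
                ∃ (a b : ℕ) (d : LDSDatum a b), d.IsRegular ∧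
                  UnitaryGroup.IsNondegenerateLimitOfDiscreteSeriesAt Fp K cK 4
                    (StdForm.antidiagonal 4) hcpt4 (σ' i).1 hw hc d) ∧
            (∀ i (u : HeightOneSpectrum (𝓞 K)), ((p : ℕ) : 𝓞 K) ∈ u.asIdeal →
                u.asIdeal.ramificationIdx ℤ = 1 ∧
                  UnitaryGroup.IsUnramifiedAt Fp K cK 4 hcpt4 (σ' i).1 u) ∧
            (∀ i, ∀ v ∉ S, ((p : ℕ) : 𝓞 K) ∉ v.asIdeal →
                v.asIdeal.ramificationIdx ℤ = 1 ∧
                (∃ β, UnitaryGroup.HasBaseChangeSatakeAt Fp K cK 4 hcpt4 (σ' i).1 v β) ∧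
                ∀ β, UnitaryGroup.HasBaseChangeSatakeAt Fp K cK 4 hcpt4 (σ' i).1 v β →
                  Q i v = arithFrobPolyOfSatake ι v.residueCard 4 β) ∧
            ∀ F : MvPolynomial (HeightOneSpectrum (𝓞 K) × ℕ) ℤ,
              (∀ vk ∈ F.vars, vk.1 ∉ S ∧ ((p : ℕ) : 𝓞 K) ∉ vk.1.asIdeal) →
              (∀ i, ‖MvPolynomial.aeval
                  (fun vk : HeightOneSpectrum (𝓞 K) × ℕ => (Q i vk.1).coeff vk.2) F‖ ≤ δ) →
                ‖MvPolynomial.aeval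
                    (fun vk : HeightOneSpectrum (𝓞 K) × ℕ => (P vk.1).coeff vk.2) F‖ ≤
                  (p : ℝ) ^ (-(m : ℤ))

/-- **Cor 6.27 at `n = 2`, unramified alternative** (the form `theorem713_of_goodPlaces` consumes,
over a presented CM field). -/
def Cor627UnramTwo : Prop :=
  ∀ (Fp K : Type) [Field Fp] [NumberField Fp] [Field K] [NumberField K] [Algebra Fp K]
    (cK : K ≃ₐ[Fp] K), IsTotallyReal Fp → Module.finrank Fp K = 2 → cK ≠ 1 →
    IsTotallyComplex K →
    ∀ (hcpt : isCompact_glFiniteIntegralLevel 2 K) (p : ℕ) [Fact p.Prime]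
      (E₀ : IntermediateField ℚ K), Module.finrank ℚ E₀ = 2 ∧ IsTotallyComplex E₀ →
      HasTwoPrimesOver E₀ p →
    ∀ (π : CuspidalAutomorphicRepData 2 K hcpt), π.1.IsRegularAlgebraic →
    ∀ (ι : PadicAlgCl p ≃+* ℂ),
    ∃ (N₀ : ℕ) (R : ℕ → FramedGaloisRep K (PadicAlgCl p) 4)
      (B : HeightOneSpectrum (𝓞 K) → Multiset (PadicAlgCl p)),
      (∀ N, N₀ ≤ N → (R N).toGaloisRep.IsSemisimple) ∧
      (∀ v, Multiset.card (B v) = 2 ∧ (0 : PadicAlgCl p) ∉ B v) ∧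
      ∀ v, IsGoodPlace π p v → ∀ α : Multiset ℂ, π.1.HasSatakeParamAt v α →
        ∀ N, N₀ ≤ N → (R N).IsUnramifiedAt v ∧
          (R N).HasFrobCharpolyAt v (twistedPairPoly ι v.residueCard N α (B v))

/-- **First lemma of the line** (`u22-twisted-pair-limit`): the automorphic congruence (α)₂ and the
SHARED polarized-reciprocity fact (β) = HLTT Cor 1.3 for `U(n,n)` (in tree, N = 4 instance) give
Cor 6.27 at `n = 2`; proof route: (β) turns each approximant `σ'_{m,i}` into a genuine `r_{m,i}`
with `HasFrobCharpolyAt v (Q i v)` off `S ∪ {v ∣ p}`, then the PROVED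
`exists_semisimple_galoisRep_of_algebraValuedLimit` (n := 4, P := P^{(N)}) gives `R N`. -/
def FirstLemma : Prop :=
  TwistedPairLimitU22 → HarrisLanTaylorThorne2016_galoisRep_unitary_discreteSeries → Cor627UnramTwo

/-- Sanity: the crux decl this line must conclude, by name. -/
example : Prop := Summit.Langlands.Langlands.Theses.IrreducibilityBySelfDuality.GaloisRepGL2CMae

/-- Sanity: the proved limit theorem has the `happrox` shape used in (α)₂ (statement reference). -/
example := @exists_semisimple_galoisRep_of_algebraValuedLimit

end

end Summit.Langlands.Langlands.Cruxes.GaloisRepGL2CMae.Sketch
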